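import Summits.Parity.GeneralizedHardyLittlewood.Theorems.FordMaynardSieveConst01651SieveConst01651Witness
import HarnessLib

/-!
# Route `FordMaynardSieveConst01651`, target `SieveConst01651` (stmt-Parity-19185), stub `stub_certValuePos` (R2):
# the `g₂` table has unique keys, so the lookup is a sum over the entries

Def-free helper file (step (2) of the `certP`/`certN` soundness, see `…CertAssembly`): the checker iterates over the
ENTRIES of `certG2` while the witness `gTab 2` reads the table through `g2Lookup` (`List.find?` on the key
`(a, b, j)`).  The keys are pairwise distinct (`certG2_keys_nodup`, from the strictly increasing encoded keys `certG2_keys_chain`, kernel `decide`), hence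

  `g2Lookup a b j = Σ_{e ∈ certG2} [key e = (a,b,j)] · c_e`   (`g2Lookup_eq_sum`),

from the generic `find?_val_eq_sum_of_nodup`.

References: folklore.
-/

namespace Summit.Parity.GeneralizedHardyLittlewood.FordMaynardSieveConst01651SieveConst01651

/-- The encoded keys `10⁶a + 10³b + j` of the `g₂` table are strictly increasing (kernel evaluation, `O(n)`).
[folklore] -/
theorem certG2_keys_chain : (certG2.map fun e => e.1 * 1000000 + e.2.1 * 1000 + e.2.2.1).IsChain (· < ·) := by
  decide +kernel

/-- The keys `(a, b, j)` of the `g₂` table are pairwise distinct. [folklore] -/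
theorem certG2_keys_nodup : (certG2.map fun e => (e.1, e.2.1, e.2.2.1)).Nodup := by
  have h := certG2_keys_chain
  rw [List.isChain_iff_pairwise] at h
  have hnd : (certG2.map fun e => e.1 * 1000000 + e.2.1 * 1000 + e.2.2.1).Nodup := h.imp ne_of_lt
  have hmap : (certG2.map fun e => e.1 * 1000000 + e.2.1 * 1000 + e.2.2.1) =
      (certG2.map fun e => (e.1, e.2.1, e.2.2.1)).map (fun k : ℕ × ℕ × ℕ => k.1 * 1000000 + k.2.1 * 1000 + k.2.2) := by
    rw [List.map_map]; rfl
  rw [hmap] at hnd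
  exact hnd.of_map _

/-- For a list with pairwise distinct keys, the `find?`-lookup of the value at a key is the sum of the values of the
entries carrying that key. [folklore] -/
theorem find?_val_eq_sum_of_nodup : ∀ (l : List (ℕ × ℕ × ℕ × ℤ)),
    (l.map fun e => (e.1, e.2.1, e.2.2.1)).Nodup → ∀ a b j : ℕ,
      (match l.find? (fun e => e.1 == a && e.2.1 == b && e.2.2.1 == j) with
        | some e => e.2.2.2
        | none => 0) =
      (l.map fun e => if e.1 = a ∧ e.2.1 = b ∧ e.2.2.1 = j then e.2.2.2 else 0).sum
  | [], _, a, b, j => by simp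
  | e :: l, hnd, a, b, j => by
    rw [List.map_cons, List.nodup_cons] at hnd
    rw [List.find?_cons, List.map_cons, List.sum_cons]
    by_cases hk : e.1 = a ∧ e.2.1 = b ∧ e.2.2.1 = j
    · have hb : (e.1 == a && e.2.1 == b && e.2.2.1 == j) = true := by simp [hk.1, hk.2.1, hk.2.2]
      rw [hb, if_pos hk]
      simp only
      -- no later entry has the same key
      have hrest : (l.map fun e => if e.1 = a ∧ e.2.1 = b ∧ e.2.2.1 = j then e.2.2.2 else 0).sum = 0 := by
        apply List.sum_eq_zero
        intro x hx
        rw [List.mem_map] at hx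
        obtain ⟨e', he', rfl⟩ := hx
        rw [if_neg]
        rintro ⟨h1, h2, h3⟩
        apply hnd.1
        rw [List.mem_map]
        exact ⟨e', he', by rw [h1, h2, h3, hk.1, hk.2.1, hk.2.2]⟩
      rw [hrest, add_zero]
    · have hb : (e.1 == a && e.2.1 == b && e.2.2.1 == j) = false := by
        rw [Bool.eq_false_iff]
        intro h
        apply hk
        simp only [Bool.and_eq_true, beq_iff_eq] at h
        exact ⟨h.1.1, h.1.2, h.2⟩
      rw [hb, if_neg hk, zero_add]
      exact find?_val_eq_sum_of_nodup l hnd.2 a b j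

/-- **The `g₂` lookup as a sum over the table entries.** [folklore] -/
theorem g2Lookup_eq_sum (a b j : ℕ) :
    g2Lookup a b j = (certG2.map fun e => if e.1 = a ∧ e.2.1 = b ∧ e.2.2.1 = j then e.2.2.2 else 0).sum := by
  unfold g2Lookup
  exact find?_val_eq_sum_of_nodup certG2 certG2_keys_nodup a b j

end Summit.Parity.GeneralizedHardyLittlewood.FordMaynardSieveConst01651SieveConst01651
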